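import Summits.BirchSwinnertonDyer.BirchSwinnertonDyer.Theorems.SignedLowerHalvesSmallImageLowerHalfBothSignsRttJunctionShaOfPT
import Summits.BirchSwinnertonDyer.BirchSwinnertonDyer.Theorems.SignedLowerHalvesSmallImageLowerHalfBothSignsRttJunctionShaRhoTwoFinite
import HarnessLib

/-!
# Route `SignedLowerHalves`, crux L `SmallImageLowerHalfBothSigns` (stmt-BirchSwinnertonDyer-23599), line `rtt_w3` v31 → v32 — row S3α from ρ₂ + the Poitou–Tate map π (S3α″), LEAD g14

WHY (HELPER-TABLE addendum 31; honda g28 KEY 2026-08-31T07:39Z). Row S3α (`λ(H²₂/T₂) ≤ λ(Y′)`) is derived (p813666 `lambdaInvariant_quot_le_strictDual_of_PT`) from its Poitou–Tate core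
S3α′ «for every `I₂`: a finite-target `Λ`-linear `ρ` on `I₂.H` and a `Λ`-linear `π : Y′ → I₂.H` with `ker ρ ≤ range π`». honda g28 has LANDED the `ρ`-half in the shape
(★★★ `exists_rhoTwo_finite_of_frameSupp`, p815886) «`∃ Loc finite, ρ, ∀ b, ρ b = 0 ↔ LOC b`», where `LOC b` := every degree-2 localisation of every conjugate of every level projection of `b`
at the places of `supp(p𝔣)` vanishes (`mem_ker_semilocMapPi₂_iff_forall_loc`). THIS FILE is the stable glue for the v32 registry act: S3α follows from ANY `ρ`-half of that shape plus the
`π`-half in the matching shape — S3α″ «`∃ π : Y′ →ₗ[Λ] I₂.H, ∀ b, LOC b → b ∈ range π`» (the -w3 lineage's α5′ TARGET, verbatim) — so that the skeleton's registered S3α-stub can be exactly S3α″.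
* ★★ `lambdaInvariant_quot_le_strictDual_of_rho_of_pi` — `(∀ I₂, ∃ Loc … ρ, ∀ b, ρ b = 0 ↔ LOC I₂ b) → (∀ I₂, ∃ π, ∀ b, LOC I₂ b → b ∈ range π) → λ(H²₂/T₂) ≤ λ(Y′)`, for an ARBITRARY
  predicate `LOC` (so neither honda's vp-input nor the exact localisation vocabulary enters this file).
THEOREMS ONLY (`--supports stmt-BirchSwinnertonDyer-23599` helper); closes nothing; S3α″, crux L and BSD remain OPEN and are proved for NO curve by any of this.
[cite: NeukirchSchmidtWingberg2008, Ch. VIII §6 (8.6.10)] [cite: Kobayashi2003, Thm. 7.3 i)] [cite: Washington1997, §13.2]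
-/

set_option autoImplicit false
-- the Theorems namespace of this sub repeats the summit name by design (D-0017 nested layout)
set_option linter.dupNamespace false

noncomputable section

open scoped NumberField
open Field IsDedekindDomain NumberField
open Literature.NumberTheory.GaloisRepresentations
open Literature.NumberTheory.EllipticCurves
open Literature.NumberTheory.ComplexMultiplication.EllipticUnits (IwasawaAlgebraO₂)
open Literature.NumberTheory.ComplexMultiplication.EllipticUnits.JohnsonLeungKings2011
open Summit.BirchSwinnertonDyer.BirchSwinnertonDyer.Theorems.SmallImageRttD2J1
open Summit.BirchSwinnertonDyer.BirchSwinnertonDyer.Theorems.SmallImageCharSignedSelmer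

namespace Summit.BirchSwinnertonDyer.BirchSwinnertonDyer.Theorems.SmallImageRttJunctionSha

variable {K : Type} [Field K] [NumberField K] {p : ℕ} [Fact p.Prime] (S : Set (PadicAlgCl p)) [FiniteDimensional ℚ_[p] (padicCoeffField S)]
  (κ₁ κ₂ : ZpExtension K p) {γK γ₂ : absoluteGaloisGroup K} (hγK : κ₁.IsTopGenerator γK)
  (θ' : absoluteGaloisGroup K →ₜ* (padicCoeffIntegers S)ˣ) (𝔣 : Ideal (𝓞 K))
  {M : Type} [AddCommGroup M] [DistribMulAction (absoluteGaloisGroup K) M] [TopologicalSpace M] [DiscreteTopology M] [Module (padicCoeffIntegers S) M]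
  {V : WeierstrassCurve K} {j : V.geomPrimaryTorsion p →+ M} {S₀ : Set (HeightOneSpectrum (𝓞 K))} {ε : ℤˣ}
  (Dψ : SignedTransportDualDataSat κ₁ γK M (padicCoeffIntegers S) V j S₀ ε) (S₁ : Set (HeightOneSpectrum (𝓞 K)))
  (htorM : ∀ m : M, ∃ k : ℕ, p ^ k • m = 0)
  (hstab : ∀ m : M, IsOpen (MulAction.stabilizer (absoluteGaloisGroup K) m : Set (absoluteGaloisGroup K)))

/-- ★★ **Row S3α from a `ρ`-half and a `π`-half sharing an arbitrary "locally trivial" predicate `LOC`.** If for every pinned degree-2 cyclotomic datum `I₂` (i) there are a FINITE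
`Λ`-module `Loc` and a `Λ`-linear `ρ : I₂.H → Loc` with `ρ b = 0 ↔ LOC I₂ b` (honda g28 `exists_rhoTwo_finite_of_frameSupp`: `LOC` = all degree-2 localisations at `supp(p𝔣)` vanish), and
(ii) there is a `Λ`-linear `π : Y′ → I₂.H` with `LOC I₂ b → b ∈ range π` (the Poitou–Tate map, -w3 lineage α5′), then `λ_Λ(QuotSMulTop (C (X − C 0)) D₂'.H) ≤ λ_Λ(Y′)` — via
`lambdaInvariant_quot_le_strictDual_of_PT` (α1 + Ш-socket + `Y′` f.g. torsion). [cite: NeukirchSchmidtWingberg2008, Ch. VIII §6 (8.6.10)] [cite: Kobayashi2003, Thm. 7.3 i)] -/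
theorem lambdaInvariant_quot_le_strictDual_of_rho_of_pi
    (hγ : ∃ u₁ u₂ : ℤ_[p]ˣ, ZpExtension.IsTopGeneratorPair (κ₁.unitTwist u₁) (κ₂.unitTwist u₂) γK⁻¹ γ₂) (h𝔣 : 𝔣 ≠ ⊥)
    (D₂' : IwasawaCohomologyDataO S κ₁ κ₂ γK⁻¹ γ₂ θ' 𝔣 2)
    [Module.Finite (IwasawaAlgebra p) Dψ.X] (htor : Module.IsTorsion (IwasawaAlgebra p) Dψ.X)
    (LOC : ∀ I₂ : CycIwasawaCohomologyDataO S κ₁ γK⁻¹ θ' (suppPF p 𝔣) 2, I₂.H → Prop)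
    (hρ : ∀ I₂ : CycIwasawaCohomologyDataO S κ₁ γK⁻¹ θ' (suppPF p 𝔣) 2,
      letI := I₂.moduleIwasawa
      ∃ (Loc : Type) (_ : AddCommGroup Loc) (_ : Module (IwasawaAlgebra p) Loc) (_ : Finite Loc) (ρ : I₂.H →ₗ[IwasawaAlgebra p] Loc),
        ∀ b : I₂.H, ρ b = 0 ↔ LOC I₂ b)
    (hπ : ∀ I₂ : CycIwasawaCohomologyDataO S κ₁ γK⁻¹ θ' (suppPF p 𝔣) 2,
      letI := I₂.moduleIwasawa
      letI := SmallImageRttD2Seq.strictDualModule κ₁ (padicCoeffIntegers S) V j S₀ ε S₁ htorM hstab hγK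
      ∃ π : (↥(SmallImageRttD2Seq.strictSelmer κ₁ M (padicCoeffIntegers S) V j S₀ ε S₁) →+ AddCircle (1 : ℚ)) →ₗ[IwasawaAlgebra p] I₂.H,
        ∀ b : I₂.H, LOC I₂ b → b ∈ LinearMap.range π) :
    letI : Module (IwasawaAlgebra p) (QuotSMulTop (PowerSeries.C (PowerSeries.X - PowerSeries.C (0 : padicCoeffIntegers S)) : IwasawaAlgebraO₂ S) D₂'.H) :=
      Module.compHom _ ((PowerSeries.map (PowerSeries.C : padicCoeffIntegers S →+* IwasawaAlgebraO S)).comp (iwasawaToIwasawaO S))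
    letI := SmallImageRttD2Seq.strictDualModule κ₁ (padicCoeffIntegers S) V j S₀ ε S₁ htorM hstab hγK
    lambdaInvariant p (QuotSMulTop (PowerSeries.C (PowerSeries.X - PowerSeries.C (0 : padicCoeffIntegers S)) : IwasawaAlgebraO₂ S) D₂'.H) ≤
      lambdaInvariant p (↥(SmallImageRttD2Seq.strictSelmer κ₁ M (padicCoeffIntegers S) V j S₀ ε S₁) →+ AddCircle (1 : ℚ)) := by
  refine lambdaInvariant_quot_le_strictDual_of_PT S κ₁ κ₂ hγK θ' 𝔣 Dψ S₁ htorM hstab hγ h𝔣 D₂' htor fun I₂ ↦ ?_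
  letI := I₂.moduleIwasawa
  letI := SmallImageRttD2Seq.strictDualModule κ₁ (padicCoeffIntegers S) V j S₀ ε S₁ htorM hstab hγK
  obtain ⟨Loc, i1, i2, hfin, ρ, hker⟩ := hρ I₂
  obtain ⟨π, hrange⟩ := hπ I₂
  exact ⟨Loc, i1, i2, hfin, ρ, π, fun b hb ↦ hrange b ((hker b).mp (LinearMap.mem_ker.mp hb))⟩

end Summit.BirchSwinnertonDyer.BirchSwinnertonDyer.Theorems.SmallImageRttJunctionSha
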